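import Mathlib
import HarnessLib
import Literature.Analysis.FluidPDE.SelfSimilar
import Literature.Analysis.FluidPDE.KochTataru
import Literature.Analysis.FluidPDE.MildSolution
import Literature.Analysis.FluidPDE.VectorCalculus
import Literature.Analysis.FluidPDE.ClassicalSolution
import Literature.Analysis.FluidPDE.PineauVicolRSS
import Literature.Analysis.FluidPDE.Superhelicity
import Summits.NavierStokesRegularity.NavierStokesRegularity.Theses.SymmetryModuliCount

/-!
# Sketch — crux-ideate, crux `SymmetricLiouville` (stmt-NavierStokesRegularity-4053), round 1, ideator 1 (gen 2)

First lemmas of the two idea cards of this seat, stated over existing declarations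
(`def … : Prop`, no proofs; one sorry-free composition lemma):

* card `trace-anomaly-sum-rules` — §A: exact interior identities for a rotated self-similar (RSS)
  element forced by the SCALING ANOMALY of critical / supercritical balance laws, whose coefficients
  are read off the blow-up TRACE `u₀ = u(0, ·)` (§A1 energy/dissipation, §A2 helicity/superhelicity,
  §A3 critical-weight (Morawetz) identity with the point term `2π|V(0)|²`, §A4 Hardy corollary,
  §A5 the unweighted pairing of the time-translation eigenmode).
* card `period-average-past-maxprinciple` — §B: the periodic (helical h ≠ 0 / translation) leaves
  WITHOUT blow-down or compactness: average along the period, start two scalar maximum principles at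
  `t = −∞`, recover the horizontal mean from its vorticity by Hodge + the zero mean of the Oseen kernel.

`InA C u` below is VERBATIM the hypothesis block of the crux decl
`Summit.NavierStokesRegularity.NavierStokesRegularity.Theses.SymmetryModuliCount.SymmetricLiouville`
(the class 𝒜_C: smooth on t<0, divergence free, KNSS Oseen-mild, Type-I time decay with constant C).
-/

noncomputable section

namespace Summit.NavierStokesRegularity.NavierStokesRegularity.Cruxes.SymmetricLiouville.SketchIdeator1G2

open MeasureTheory Set Filter
open scoped Topology

local notation "ℝ³" => EuclideanSpace ℝ (Fin 3)

/-- The class 𝒜_C of the crux, verbatim (hypothesis block of `SymmetricLiouville`). -/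
def InA (C : ℝ) (u : ℝ → ℝ³ → ℝ³) : Prop :=
  ContDiffOn ℝ (⊤ : ℕ∞) (Function.uncurry u) (Set.Iio 0 ×ˢ Set.univ) ∧
  (∀ t < 0, Literature.Analysis.FluidPDE.VectorCalculus.IsDivFree (u t)) ∧
  (∀ s t : ℝ, s < t → t < 0 → ∀ x, u t x = Literature.Analysis.FluidPDE.heatFlow (u s) (t - s) x -
     ∫ τ in Set.Ioo s t, ∫ y, Literature.Analysis.FluidPDE.oseenKernel (t - τ) (x - y) (u τ y) (u τ y)) ∧
  Literature.Analysis.FluidPDE.HasTypeITimeDecay C u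

/-- Sanity: `InA` is literally the crux's hypothesis, so the crux reads `InA C u → (symmetry) → u ≡ 0`. -/
theorem symmetricLiouville_iff :
    Summit.NavierStokesRegularity.NavierStokesRegularity.Theses.SymmetryModuliCount.SymmetricLiouville ↔
    ∀ (C : ℝ) (u : ℝ → ℝ³ → ℝ³), InA C u →
      ∀ (a : ℝ³) (σ : ℝ) (A : ℝ³ →L[ℝ] ℝ³), (∀ x, inner ℝ (A x) x = 0) → ¬ (a = 0 ∧ σ = 0 ∧ A = 0) →
        (∀ t < 0, ∀ x, fderiv ℝ (u t) x (a + σ • x + A x) + σ • u t x +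
          (2 * σ * t) • Literature.Analysis.FluidPDE.timeDeriv u t x - A (u t x) = 0) →
        ∀ t < 0, ∀ x, u t x = 0 :=
  Iff.rfl

/-- Squared Frobenius norm `|∇V(y)|² = Σⱼ ‖∂ⱼV(y)‖²` of the velocity gradient. -/
def gradSq (V : ℝ³ → ℝ³) (y : ℝ³) : ℝ :=
  ∑ j : Fin 3, ‖fderiv ℝ V y (EuclideanSpace.single j (1 : ℝ))‖ ^ 2

/-- **RSS element of the crux's class in the decaying (Pineau–Vicol) form.** `u ∈ 𝒜_C` is backwards
rotated self-similar about `(0,0)` with rate `α` and `C²` profile `V` (the in-tree `pvAnsatz` with an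
`s`-independent profile, PV (1.7)), and obeys the space–time Type-I bound (1.10) = `HasTypeIDecay C₀`
(which cards `degenerate-stabiliser-zoom` / `stabiliser-at-infinity-decay` derive for every spiral-symmetric
element of 𝒜_C; it is where the residual open core `RotatedSelfSimilarLiouvilleDecaying` of
`Cruxes/SymmetricLiouville/Disproof.lean` lives). Then `V = u(−1, ·)` (PV Remark 1.3) has the exact
`1/|y|` tail `u₀ = u(0,·)` with `|∇V| ≲ (1+|y|)⁻²`, `|∇²V| ≲ (1+|y|)⁻³` (PV Lemma 2.1). -/
def IsRssElement (C C₀ α : ℝ) (u : ℝ → ℝ³ → ℝ³) (V : ℝ³ → ℝ³) : Prop :=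
  InA C u ∧ Literature.Analysis.FluidPDE.HasTypeIDecay C₀ u ∧ ContDiff ℝ 2 V ∧
    ∀ t < 0, ∀ x, u t x = Literature.Analysis.FluidPDE.pvAnsatz α (fun y _ => V y) t x

/-! ## §A — card `trace-anomaly-sum-rules` -/

/-- **A1 (dissipation = ¼ · renormalised energy; the energy anomaly).** For an RSS element the
spherical energy `∫_{B_R}|V|²` grows linearly, `e₀ := lim R⁻¹∫_{B_R}|V|² = ∫_{S²}|u₀|²` (the trace's
energy density per unit radius), the renormalised energy `E := lim (∫_{B_R}|V|² − e₀R)` exists, and the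
exact energy balance of Navier–Stokes, whose only anomaly under the RSS scaling is `E(t) = √(−t)E`,
forces `∫_{ℝ³}|∇V|² = E/4` — signed left-hand side, `α`- and `C`-uniform, weight-free (legal because
`|∇V| ≲ |y|⁻²` is square integrable). -/
def RssDissipationAnomaly : Prop :=
  ∀ (C C₀ α : ℝ) (u : ℝ → ℝ³ → ℝ³) (V : ℝ³ → ℝ³), IsRssElement C C₀ α u V →
    ∃ e₀ E : ℝ,
      Tendsto (fun R : ℝ => (∫ y in Metric.ball (0 : ℝ³) R, ‖V y‖ ^ 2) / R) atTop (𝓝 e₀) ∧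
      Tendsto (fun R : ℝ => (∫ y in Metric.ball (0 : ℝ³) R, ‖V y‖ ^ 2) - e₀ * R) atTop (𝓝 E) ∧
      ∫ y, gradSq V y = E / 4

/-- **A2 (superhelicity = −¼ · helicity anomaly; the chirality sum rule).** Helicity is the critical
(scale-invariant) inviscid invariant, so `∫_{B_R} V·curl V = h₀ log R + H + o(1)` is log-divergent with
coefficient `h₀ = ∫_{S²} u₀ · curl u₀` (spherical helicity of the trace); the viscous helicity balance
`dH/dt = −2·superhelicity` (in tree: `IsClassicalNSSolutionOn.hasDerivWithinAt_helicity`) and the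
anomaly `H(t) = H − (h₀/2) log(−t)` force `∫ ⟪curl V, curl curl V⟫ = −h₀/4` (absolutely convergent:
`|curl V| ≲ |y|⁻²`, `|curl curl V| ≲ |y|⁻³`). -/
def RssHelicityAnomaly : Prop :=
  ∀ (C C₀ α : ℝ) (u : ℝ → ℝ³ → ℝ³) (V : ℝ³ → ℝ³), IsRssElement C C₀ α u V →
    ∃ h₀ : ℝ,
      Tendsto (fun R : ℝ =>
        (∫ y in Metric.ball (0 : ℝ³) R, inner ℝ (V y) (Literature.Analysis.FluidPDE.curl V y)) / Real.log R)
        atTop (𝓝 h₀) ∧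
      Literature.Analysis.FluidPDE.superhelicity V = -(h₀ / 4)

/-- **A3 (the critical-weight / Morawetz sum rule).** `∫|u|²/|x|` is scale invariant, hence log-divergent
on an RSS element with the SAME coefficient `e₀`; its balance law (pure calculus: `Δ|x|⁻¹ = −4πδ₀`,
`div u = 0`; kit job of this seat checks the integration by parts numerically) reads, at `t = −1` with the
decaying pressure `P = p(−1,·) → 0` at infinity (`P = RᵢRⱼ(VᵢVⱼ)`, PV Lemma 2.1),
`∫|∇V|²/|y| + 2π|V(0)|² + e₀/4 = −∫ (½|V|² + P)(V·y)/|y|³`: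
three non-negative terms on the left (strictly positive for `V ≢ 0`), the `|y|⁻²`-weighted radial flux of
total head on the right — a nontrivial profile transports Bernoulli head INWARD on average. -/
def RssMorawetzIdentity : Prop :=
  ∀ (C C₀ α : ℝ) (u : ℝ → ℝ³ → ℝ³) (V : ℝ³ → ℝ³) (p : ℝ → ℝ³ → ℝ), IsRssElement C C₀ α u V →
    Literature.Analysis.FluidPDE.IsClassicalNSSolutionOn (Set.Iio 0) 1 0 u p →
    Tendsto (p (-1)) (cocompact ℝ³) (𝓝 0) →
    ∃ e₀ : ℝ,
      Tendsto (fun R : ℝ => (∫ y in Metric.ball (0 : ℝ³) R, ‖V y‖ ^ 2) / R) atTop (𝓝 e₀) ∧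
      (∫ y, gradSq V y / ‖y‖) + 2 * Real.pi * ‖V 0‖ ^ 2 + e₀ / 4 =
        -∫ y, (‖V y‖ ^ 2 / 2 + p (-1) y) * inner ℝ (V y) y / ‖y‖ ^ 3

/-- **A4 (Hardy corollary: energy pile-up).** Hardy's inequality `∫|∇V|² ≥ ¼∫|V|²/|y|²` (strict for
`V ≢ 0`) and A1 give `∫|V|²/|y|² < E = lim(∫_{B_R}|V|² − e₀R)`: in terms of the spherical energy
`f(r) = ∫_{S_r}|V|²`, `∫₀^∞ f r⁻² dr < ∫₀^∞ (f − e₀) dr`, so `f` must OVERSHOOT its asymptotic value `e₀`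
(the scale-invariant spherical energy `r²⟨|V|²⟩` of a nontrivial profile is not monotone in `r`). -/
def RssHardyOvershoot : Prop :=
  ∀ (C C₀ α : ℝ) (u : ℝ → ℝ³ → ℝ³) (V : ℝ³ → ℝ³), IsRssElement C C₀ α u V → V ≠ 0 →
    ∃ e₀ E : ℝ,
      Tendsto (fun R : ℝ => (∫ y in Metric.ball (0 : ℝ³) R, ‖V y‖ ^ 2) / R) atTop (𝓝 e₀) ∧
      Tendsto (fun R : ℝ => (∫ y in Metric.ball (0 : ℝ³) R, ‖V y‖ ^ 2) - e₀ * R) atTop (𝓝 E) ∧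
      (∫ y, ‖V y‖ ^ 2 / ‖y‖ ^ 2) < E

/-- **A5 (the time-translation eigenmode, paired without weight).** `Ψ := ΔV − (V·∇)V − ∇P`
(= `½(V + y·∇V) + α(JV − ∂_θV)` by PV (1.8a) = `−√(−t)·∂ₛ`-mode, cf. PV Remark 1.10) is the
eigenfunction with eigenvalue `1` of the co-rotating linearised Leray operator at `V`; it decays like
`|y|^{-3+σ}` (trace expansion), so the UNWEIGHTED `L²` pairing is legal and pressure-free, giving
`¾‖Ψ‖² + ‖∇Ψ‖² = −∫ ⟪Ψ, (∇V)Ψ⟫`: the compressive strain of a nontrivial profile exceeds `3/4`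
(in similarity units) on the Rayleigh quotient of its own time-translation mode; `Ψ ≢ 0` unless `V ≡ 0`. -/
def RssTimeModePairing : Prop :=
  ∀ (C C₀ α : ℝ) (u : ℝ → ℝ³ → ℝ³) (V : ℝ³ → ℝ³) (p : ℝ → ℝ³ → ℝ), IsRssElement C C₀ α u V →
    Literature.Analysis.FluidPDE.IsClassicalNSSolutionOn (Set.Iio 0) 1 0 u p →
    Tendsto (p (-1)) (cocompact ℝ³) (𝓝 0) →
    let Ψ : ℝ³ → ℝ³ := fun y =>
      Laplacian.laplacian V y - Literature.Analysis.FluidPDE.convect V V y - gradient (p (-1)) y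
    (3 / 4) * (∫ y, ‖Ψ y‖ ^ 2) + (∫ y, gradSq Ψ y) = -∫ y, inner ℝ (Ψ y) (fderiv ℝ V y (Ψ y))

/-! ## §B — card `period-average-past-maxprinciple` -/

/-- Average of `u(t,·)` over one period `e`: `ū(t,x) = ∫₀¹ u(t, x + θe) dθ` (independent of the
`e`-direction when `u(t, · + e) = u(t, ·)`). -/
def periodMean (u : ℝ → ℝ³ → ℝ³) (e : ℝ³) (t : ℝ) (x : ℝ³) : ℝ³ :=
  ∫ θ in (0 : ℝ)..1, u t (x + θ • e)

/-- **B1 (slaving of the fluctuation, no spectral theory needed).** A period-`e` element of 𝒜_C differs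
from its period average by `O_m(|e|^m (−t)^{−(1+m)/2})` for every `m` (Wirtinger along the period +
the scale-invariant KNSS smoothing bounds `|∂^m u| ≤ C_m (−t)^{−(1+m)/2}`, in tree
`knss2009_smoothing_holds`); the same holds for every space derivative. In scale-invariant units the
non-2.5-D part of `u` is `O((|e|/√(−t))^m)`: super-polynomially small in the past. -/
def PeriodicFluctuationDecay : Prop :=
  ∀ (C : ℝ) (u : ℝ → ℝ³ → ℝ³) (e : ℝ³), InA C u → e ≠ 0 → (∀ t < 0, ∀ x, u t (x + e) = u t x) →
    ∀ m : ℕ, ∃ K : ℝ, ∀ t < 0, ∀ x, ‖u t x - periodMean u e t x‖ ≤ K * ‖e‖ ^ m / (-t) ^ (((m : ℝ) + 1) / 2)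

/-- **B2 (two maximum principles started at t = −∞).** The period average `ū` is 2.5-D; its axial
vorticity `ω̄·ê` obeys a SCALAR advection–diffusion equation (no stretching in 2.5-D) forced by the eddy
term of B1, and so does the axial velocity `ū·ê` (the mild pressure `RᵢRⱼ(uᵢuⱼ)` is periodic, so the
averaged axial pressure gradient vanishes). Both maximum principles are started at `s → −∞`, where
Type-I decay makes the data vanish (`|ω̄(s)| ≤ C₁/(−s)`, `|ū(s)| ≤ C/√(−s)`), and the forcing is
`O((−t)^{−N})` by B1: hence `(−t)‖ω̄·ê‖_∞ → 0` and `√(−t)‖ū·ê‖_∞ → 0` as `t → −∞`. -/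
def MeanAxialPastVanishing : Prop :=
  ∀ (C : ℝ) (u : ℝ → ℝ³ → ℝ³) (e : ℝ³), InA C u → e ≠ 0 → (∀ t < 0, ∀ x, u t (x + e) = u t x) →
    ∀ ε > 0, ∃ T < 0, ∀ t < T, ∀ x,
      (-t) * |inner ℝ (Literature.Analysis.FluidPDE.curl (periodMean u e t) x) e| ≤ ε * ‖e‖ ∧
      Real.sqrt (-t) * |inner ℝ (periodMean u e t x) e| ≤ ε * ‖e‖

/-- **B3 (horizontal mean from its vorticity: Hodge + the zero mean of the Oseen kernel).** Given B2,
on balls of radius `ρ = √(−t)M` the horizontal mean is `∇⊥ψ + ∇φ` with `|∇ψ| ≲ ρ‖ω̄·ê‖_∞` and `φ`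
harmonic, whose gradient oscillates by `≤ c(r/ρ)·C/√(−t)` on `B_r`: `ū` is nearly CONSTANT on scales
`≫ √(−t)`; the KNSS-mild identity from `s = −∞` then kills near-constants because the Oseen kernel
`∇e^{σΔ}P` has zero mean and an integrable `(|z|+√σ)⁻⁴` tail (in tree: `norm_oseenKernel_le`,
`integral_oseenKernel_sub_left_eq_zero` — the quantitative form of "constants are not mild",
KNSS Rem. 6.1), with the far past controlled by Type-I decay. Output: the whole period average is small
in the past. -/
def MeanPastSmallness : Prop :=
  ∀ (C : ℝ) (u : ℝ → ℝ³ → ℝ³) (e : ℝ³), InA C u → e ≠ 0 → (∀ t < 0, ∀ x, u t (x + e) = u t x) →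
    ∀ ε > 0, ∃ T < 0, ∀ t < T, ∀ x, Real.sqrt (-t) * ‖periodMean u e t x‖ ≤ ε

/-- **B4 (small past ⇒ zero; shared with the blow-down cards, e.g. `PastSmallnessLiouville` of
`SketchIdeator1`, `SmallAtMinusInfinityLiouville` of `SketchIdeator2`).** -/
def PastSmallnessLiouville : Prop :=
  ∀ (C : ℝ) (u : ℝ → ℝ³ → ℝ³), InA C u →
    (∀ ε > 0, ∃ T < 0, ∀ t < T, ∀ x, Real.sqrt (-t) * ‖u t x‖ ≤ ε) →
    ∀ t < 0, ∀ x, u t x = 0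

/-- **B5 (u itself is small in the past)** — the statement fed to B4; it follows from B1 (m = 1) and B3
by the triangle inequality (`√(−t)·K|e|/(−t) → 0`). Kept as a named step so that the composition below is
pure logic. -/
def PeriodicPastSmallness : Prop :=
  ∀ (C : ℝ) (u : ℝ → ℝ³ → ℝ³) (e : ℝ³), InA C u → e ≠ 0 → (∀ t < 0, ∀ x, u t (x + e) = u t x) →
    ∀ ε > 0, ∃ T < 0, ∀ t < T, ∀ x, Real.sqrt (-t) * ‖u t x‖ ≤ ε

/-- **Target of the card: the periodic Liouville theorem in 𝒜_C** (⇒ leaves (T) and (R_h, h ≠ 0) of the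
crux via `HelicalIsPeriodic`/`periodic_of_screw` of the sibling sketches, ⇒ `Disproof.HelicalTypeILiouville`). -/
def PeriodicTypeIAncientLiouville : Prop :=
  ∀ (C : ℝ) (u : ℝ → ℝ³ → ℝ³) (e : ℝ³), InA C u → e ≠ 0 → (∀ t < 0, ∀ x, u t (x + e) = u t x) →
    ∀ t < 0, ∀ x, u t x = 0

/-- The composition is pure logic. -/
theorem periodicTypeIAncientLiouville_of (h5 : PeriodicPastSmallness) (h4 : PastSmallnessLiouville) :
    PeriodicTypeIAncientLiouville :=
  fun C u e hu he hper => h4 C u hu (h5 C u e hu he hper)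

end Summit.NavierStokesRegularity.NavierStokesRegularity.Cruxes.SymmetricLiouville.SketchIdeator1G2

end
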